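import Summits.ABC.IUTFork.Cor312LicenceContentCriterion
import Summits.ABC.IUTFork.Cor312ThetaSideEqualM
import Summits.ABC.IUTFork.Cor312PilotIdelesMInclusion
import Summits.ABC.IUTFork.Cor312VolumesPadicLatticeScaled
import Literature.IUT.LogVolume.TensorPacketContentExact
import HarnessLib

/-!
# [IUTchIII] Cor. 3.12, Step (xi-f): the LICENCE / hull-level clause S_H at the M-LEVEL sharp setting of record
# `settingPrVolSharpM`, decided EXACTLY per summand by ONE content integer and the radii of the unit-log lattices

PROOF-ONLY record file (D-0012; no definitions, no `Prop` facts, no instances) of the abc-iut cell (WAVE-5 prover seat abc-iut-w5-d166,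
gen 6 — G1-Θ / M-line lineage; D-0079 R-W «WINDOW Θ-SIDE INEQUALITY», lane U, row «W:M-LICENCE-EXACT», HOME/STATUS 2026-08-26T16:19:39Z;
part 2 of 2 over `Cor312LicenceContentCriterion`; the M-SETTING twin of abc-iut-w4-d036's K-setting wrapper, consuming abc-iut-c312-5's
exact-content cell «T2-EXACT-CONTENT» BY NAME). TAKES NO SIDE on [IUTchIII] Cor. 3.12 (kurims manuscript p. 173–174; Step (xi-f) p. 184).

OBJECT: S_H = `Cor312Vol.PilotKummerCompatHull` (pinned reading) / `Thm311ToCor312.Licence` — the `hSHw` / `hNumOffBad_M` binder of the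
M-line certificates of record (abc-iut-C-cert-3 p445989, p451523, p453684) — at abc-iut-s2-p8's summand-route M-LEVEL sharp setting
`Thm311.Real.settingPrVolSharpM D hlog t tq …` (carriers `K_{v̲}`, `v̲ ∈ V̲`, [IUTchI] Def. 3.1 (e); sharp Θ-boxes `ι_j(t_{Θ,j,v̲_j})·(R_I)^∼`,
q-centre `λ_q`; idele BINDERS `t`, `tq`). PROVED (all strata — tame, boundary, wild, `p = 2` —, MIXED summands included; `p = p_u`):
* §2 the dischargers of part 1's `hsub` (abc-iut-c312-5's capsule-symmetric scaled log-shell lattice `e⁻¹(Π_{v⃗} p^{m(v⃗)}·log_p(R_{v⃗}^×))`,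
  `PadicPresentation.image_latticePkS_of_mem_closure_of_symm`) and `hwit` (abc-iut-s2-p9's permutation argument, any label, any Θ-ideles),
  and **`qRegion_subset_thetaHull_settingPrVolSharpM_iff_of_content`**: for a capsule-symmetric EXACT content family `m` of the (Ind1)-slot
  unions `⋃_a ι_a(t_{Θ,j,v̲_a})·(R_I)^∼` and norm-dominating `cout(v̲) ∈ log_p(𝒪^×_{K_{v̲}})`, «`qRegion (j,u) ⊆ ⁿ˒°𝒰_{j,u}` ⟺
  `∀ v⃗, p^{m(v⃗)}·‖t_{q,v̲_j}‖ ≤ ∏_a ‖cout(v̲_a)‖`»; archimedean packets automatic;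
* §3 CONTENT-FREE forms: **`…_iff`** («⟺ `∀ v⃗ ∀ m ∈ ℤ`, slot union `⊆ p^m·log_p(R_{v⃗}^×)` `→ p^m·‖t_{q,v̲_j}‖ ≤ ∏_a ‖cout(v̲_a)‖`»; the content
  EXISTS and is capsule-symmetric — abc-iut-s2-p7 `exists_content_slotUnion`, `content_slotUnion_perm`) and, with abc-iut-c312-5's exact
  content cell `iota_smul_normalizedPacket_subset_zpow_smul_logPacket_iff` (largest inner balls `cin(v̲)·𝒪 ⊆ log_p(𝒪^×_{K_{v̲}})`),
  **`…_iff_radii`**: «⟺ `∀ v⃗ ∀ m`, (`∀ a J, p^m·‖t_{Θ,j,v̲_a}‖ ≤ p^{−(d_I − d_{L_J})}·∏_b ρ_in(v̲_b)`) `→ p^m·‖t_{q,v̲_j}‖ ≤ ∏_b ρ_out(v̲_b)`» — the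
  M twin of abc-iut-c312-5's cell `iota_smul_subset_packetHull_factorwiseOrbit_iota_smul_iff` with the (Ind1)-SLOT UNION for one Θ-box;
* §4 **`licence_settingPrVolSharpM_iff_radii`** (`Licence` ⟺ §3 at every `(i+1, u)`), **`forall_qRegion_subset_thetaHull_settingPrVolSharpM_iff_radii`**
  (every label — the body of `PilotKummerCompatHull` for the pinned `ρ = qRegion`, part 1 `pilotKummerCompatHull_const_iff`).

READING (neutral, numbers not adjectives): at the M line the per-packet truth value of OUR typed licence is a finite lattice computation in
the genuine `K_{v̲}`: per place (`ρ_in`, `ρ_out`) of `log_p(𝒪^×_{K_{v̲}})` and the differents — the SAME per-place columns the R-W WINDOW-TABLE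
tabulates for the K line; no M-specific numerics; it subsumes the M-level depth refutation of record (abc-iut-w5-d166 gen 5
`not_licence_settingPrVolSharpM_of_explicit`). HONEST SCOPE: the licence is a STRONGER-THAN-PRINT set-level reading of Step (xi-f)
(ADJUDICATION-SPEC §2 (G1′)); OUR sharp containers, OUR typed (Ind1)/(Ind2)/(Ind3); nothing here bears on the printed GLOBAL inequality or
on the NUMBER-level `Cor22.Cor312AtDatum`; refuted/inhabited-as-typed ≠ in print. [cite: Mochizuki2012, IUTchIII Cor. 3.12 p. 173–174,
Step (xi) p. 183–184; Thm. 3.11 (i) (Ind1)(Ind2) p. 154; Rmk. 3.9.5 (i)(ii) p. 127; IUTchIV Prop. 1.1 p. 9, Prop. 1.2 (i)(ii) p. 10;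
IUTchI Def. 3.1 (e) p. 62] [cite: DupuyHilado2025, §3.7, §3.9, §4.7, §4.9, §4.10, §4.12] [cite: WeilBNT1967, Ch. II §2, Th. 1–2]
[claim: Mochizuki2012, status: disputed] for every IUT sentence quoted. typed ≠ proved (these: proved); instantiated ≠ endorsed.
-/

noncomputable section

open Set Function NumberField IsDedekindDomain
open scoped Pointwise

/-! ## §2. The M-level setting of record: the dischargers and the per-packet criterion with a content family -/

namespace Summit.ABC.IUTFork.Thm311.Real

open Cor312 Cor312Vol Literature.IUT.LogThetaLattice Literature.IUT.LogVolume Literature.IUT.HodgeTheaters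
  Literature.NumberTheory.NumberFields Literature.NumberTheory.GaloisRepresentations.Ultrametric

variable {F K Fbar : Type} [Field F] [NumberField F] [Field K] [NumberField K] [Algebra F K]
  [Field Fbar] [Algebra F Fbar] [Algebra K Fbar] {E : WeierstrassCurve F} [E.IsElliptic] {l : ℕ}
  {Pb : BadPlacePredicates K} (D : InitialThetaData F K Fbar E l Pb) {logvK : PadicLogsVal K}
  (hlog : LogvAnalyticVal logvK)
  (t : ∀ (u : FinitePlace ℚ) (_ : Fin (thetaIndexOfInitial D).lstar) (x : (thetaIndexOfInitial D).Fibre (Val.non u)),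
    kOfM D (ratChar u) u (natCast_ratChar_mem u) x)
  (tq : ∀ (u : FinitePlace ℚ) (x : (thetaIndexOfInitial D).Fibre (Val.non u)),
    kOfM D (ratChar u) u (natCast_ratChar_mem u) x)
  (M : Type) [Field M] [NumberField M]
  (archPk : ∀ (j : (thetaIndexOfInitial D).Label) (vQ : (thetaIndexOfInitial D).VQ),
    Set ((logShellsOfInitialDH D logvK).Packet j vQ))
  (archSub : ∀ (j : (thetaIndexOfInitial D).Label) (v : (thetaIndexOfInitial D).V),
    Set ((logShellsOfInitialDH D logvK).Packet j ((thetaIndexOfInitial D).over v)))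
  (Ψ : ℤ → ∀ v : (thetaIndexOfInitial D).V, v ∈ (thetaIndexOfInitial D).Vbad →
    Set ((logShellsOfInitialDH D logvK).StarPacket v))
  (act : ℤ → ∀ v : (thetaIndexOfInitial D).V, v ∈ (thetaIndexOfInitial D).Vbad →
    (logShellsOfInitialDH D logvK).StarPacket v → Module.End ℚ ((logShellsOfInitialDH D logvK).StarPacket v))
  (Mmod : ℤ → ∀ j : (thetaIndexOfInitial D).LabelStar, Set ((logShellsOfInitialDH D logvK).GlobalPacket j.1))
  (region : ℤ → ∀ j : (thetaIndexOfInitial D).LabelStar, FinDivisor M → ∀ vQ : (thetaIndexOfInitial D).VQ,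
    Set ((logShellsOfInitialDH D logvK).Packet j.1 vQ))
  (n : ℤ) {HT : Type} {LogLink : HT → HT → Type} {IsFull : ∀ {s t : HT}, LogLink s t → Prop}
  (lat : LGPGaussianLogThetaLattice LogLink IsFull)
  {Frd : Type} {IsoF : Frd → Frd → Type} {Ob : Frd → Type} {realify : Frd → Frd} {Strip : Type}
  {IsoS : Strip → Strip → Type}
  {Mv : ∀ v : (thetaIndexOfInitial D).V, v ∈ (thetaIndexOfInitial D).Vbad → Type} [∀ v h, Monoid (Mv v h)]
  (sig : GlobalLGPFrobenioidSignature (thetaIndexOfInitial D).lstar (thetaIndexOfInitial D).V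
    (· ∈ (thetaIndexOfInitial D).Vbad) Frd IsoF Ob realify Strip IsoS Mv)
  (split : SplittingMonoids Mv) {ObΔ : Type}
  {N : ∀ v : (thetaIndexOfInitial D).V, v ∈ (thetaIndexOfInitial D).Vbad → Type} [∀ v h, Monoid (N v h)]
  (qData : QPilotData ObΔ N)
  (htq0 : ∀ u x, tq u x ≠ 0) (Sq : Finset (FinitePlace ℚ))
  (htq1 : ∀ (u : FinitePlace ℚ) (x : (thetaIndexOfInitial D).Fibre (Val.non u)), u ∉ Sq → ‖tq u x‖ = 1)

/-- **`hsub` at the M-level setting**: if every (Ind1)-SLOT UNION `⋃_a ι_a(t_{Θ,j,v̲_a})·(R_I)^∼` at `(j, u)` lies in `p^{m(v⃗)}·log_p(R_{v⃗}^×)`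
for a capsule-SYMMETRIC `m`, then so does, summand-wise, the whole union of the possible images: the (Ind3)-region is the product of the
last-slot boxes (abc-iut-s2-p9), inside abc-iut-c312-5's capsule-symmetric scaled log-shell lattice `e⁻¹(Π_{v⃗} p^{m(v⃗)}·log_p(R_{v⃗}^×))`,
which every element of `⟨Ind1 ∪ Ind2⟩` maps onto itself (`PadicPresentation.image_latticePkS_of_mem_closure_of_symm`).
[cite: DupuyHilado2025, §3.9, §4.7, §4.10] [cite: Mochizuki2012, IUTchIII Thm. 3.11 (i) (Ind1)(Ind2) p. 154] -/
theorem sUnion_possibleImages_settingPrVolSharpM_subset (j : (thetaIndexOfInitial D).Label) (u : FinitePlace ℚ)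
    (m : ((thetaIndexOfInitial D).Caps j → (thetaIndexOfInitial D).Fibre (Val.non u)) → ℤ)
    (hsymm : ∀ (σ : Equiv.Perm ((thetaIndexOfInitial D).Caps j))
      (e : (thetaIndexOfInitial D).Caps j → (thetaIndexOfInitial D).Fibre (Val.non u)), m (e ∘ σ) = m e)
    (hm0 : ∀ e : (thetaIndexOfInitial D).Caps j → (thetaIndexOfInitial D).Fibre (Val.non u),
      (⋃ a, iota (ratChar u) ((presAtM D hlog u).kk e) a ((presAtM D hlog u).labelIdele (t u) j (e a)) •
          (normalizedPacket (ratChar u) ((presAtM D hlog u).kk e) : Set ((presAtM D hlog u).X e))) ⊆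
        (((ratChar u : ℕ) : ℚ_[ratChar u]) ^ m e) • (logPacket (ratChar u) ((presAtM D hlog u).kk e) : Set ((presAtM D hlog u).X e))) :
    ⋃₀ (settingPrVolSharpM D hlog t tq M archPk archSub Ψ act Mmod region n lat sig split qData htq0 Sq htq1).possibleImages j
        (Val.non u) ⊆
      (presAtM D hlog u).comparison j ⁻¹' Set.pi univ fun e =>
        (((ratChar u : ℕ) : ℚ_[ratChar u]) ^ m e) • (logPacket (ratChar u) ((presAtM D hlog u).kk e) : Set ((presAtM D hlog u).X e)) := by
  classical
  -- abc-iut-c312-5's capsule-symmetric scalar function `p^{m(v⃗)}·(2p)^{|S^±_{j+1}|}` on the log-shells cuts out exactly this lattice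
  set c : ((thetaIndexOfInitial D).Caps j → (thetaIndexOfInitial D).Fibre (Val.non u)) → ℚ_[ratChar u] :=
    fun e => ((ratChar u : ℕ) : ℚ_[ratChar u]) ^ m e * (shellScalar (ratChar u) (I := (thetaIndexOfInitial D).Caps j))⁻¹ with hc
  have hcsymm : ∀ (σ : Equiv.Perm ((thetaIndexOfInitial D).Caps j))
      (e : (thetaIndexOfInitial D).Caps j → (thetaIndexOfInitial D).Fibre (Val.non u)), c (e ∘ σ) = c e :=
    fun σ e => by simp only [hc, hsymm σ e]
  have hlat : (presAtM D hlog u).latticePkS j c = (presAtM D hlog u).comparison j ⁻¹' Set.pi univ fun e =>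
      (((ratChar u : ℕ) : ℚ_[ratChar u]) ^ m e) • (logPacket (ratChar u) ((presAtM D hlog u).kk e) : Set ((presAtM D hlog u).X e)) := by
    unfold PadicPresentation.latticePkS PadicPresentation.summandLatticeS
    congr 1
    refine Set.pi_congr rfl fun e _ => ?_
    rw [logShell, smul_smul, hc, mul_assoc, inv_mul_cancel₀ (shellScalar_ne_zero (ratChar u)), mul_one]
  -- the (Ind3)-region (product of the LAST-slot boxes, each inside its slot union) lies in the lattice …
  have h3 : (settingPrVolSharpM D hlog t tq M archPk archSub Ψ act Mmod region n lat sig split qData htq0 Sq htq1).thetaRegion3 j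
      (Val.non u) ⊆ (presAtM D hlog u).latticePkS j c := by
    rw [hlat, thetaRegion3_settingPrVolSharpM_eq_preimage_pi D hlog tq M archPk archSub Ψ act Mmod region n lat sig split qData
      htq0 Sq htq1 t j u]
    exact Set.preimage_mono (Set.pi_mono fun e _ y hy => hm0 e (Set.mem_iUnion.mpr ⟨Fin.last _, hy⟩))
  -- … and every `Φ ∈ ⟨Ind1 ∪ Ind2⟩` maps the lattice onto itself
  intro x hx
  obtain ⟨V, ⟨Φ, hΦ, rfl⟩, ⟨y, hy, rfl⟩⟩ := Set.mem_sUnion.mp hx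
  have hmem : (Φ j (Val.non u)) y ∈ (presAtM D hlog u).latticePkS j c := by
    rw [← (presAtM D hlog u).image_latticePkS_of_mem_closure_of_symm hΦ j hcsymm]
    exact Set.mem_image_of_mem _ (h3 hy)
  rwa [hlat] at hmem

/-- **`hwit` at the M-level setting, any label, any Θ-ideles**: if `m(v⃗)` is the EXACT content of the slot union at `v⃗`, the union of
the possible images carries at `v⃗` a vector of content exactly `p^{m(v⃗)}` — the witness sits in some slot `a`, i.e. in the (Ind1)-image
`perm_σ` of the last-slot box at `v⃗∘σ`, `σ = (last a)` (abc-iut-S8 `image_permAlgEquiv_iota_smul_normalizedPacket`, abc-iut-s2-p9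
`Cor312Vol.exists_mem_sUnion_possibleImages_comparison_eq_permX`; generic-label, generic-idele form of abc-iut-s2-p9's
`exists_mem_sUnion_possibleImages_exact_content`). [cite: Mochizuki2012, IUTchIII Thm. 3.11 (i) (Ind1) p. 154] [cite: DupuyHilado2025, §4.7] -/
theorem exists_mem_sUnion_possibleImages_settingPrVolSharpM_exact_content (j : (thetaIndexOfInitial D).Label)
    (u : FinitePlace ℚ) (m : ((thetaIndexOfInitial D).Caps j → (thetaIndexOfInitial D).Fibre (Val.non u)) → ℤ)
    (e : (thetaIndexOfInitial D).Caps j → (thetaIndexOfInitial D).Fibre (Val.non u))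
    (hm0 : (⋃ a, iota (ratChar u) ((presAtM D hlog u).kk e) a ((presAtM D hlog u).labelIdele (t u) j (e a)) •
        (normalizedPacket (ratChar u) ((presAtM D hlog u).kk e) : Set ((presAtM D hlog u).X e))) ⊆
      (((ratChar u : ℕ) : ℚ_[ratChar u]) ^ m e) • (logPacket (ratChar u) ((presAtM D hlog u).kk e) : Set ((presAtM D hlog u).X e)))
    (hm1 : ¬ (⋃ a, iota (ratChar u) ((presAtM D hlog u).kk e) a ((presAtM D hlog u).labelIdele (t u) j (e a)) •
        (normalizedPacket (ratChar u) ((presAtM D hlog u).kk e) : Set ((presAtM D hlog u).X e))) ⊆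
      (((ratChar u : ℕ) : ℚ_[ratChar u]) ^ (m e + 1)) • (logPacket (ratChar u) ((presAtM D hlog u).kk e) : Set ((presAtM D hlog u).X e))) :
    ∃ x ∈ ⋃₀ (settingPrVolSharpM D hlog t tq M archPk archSub Ψ act Mmod region n lat sig split qData htq0 Sq
        htq1).possibleImages j (Val.non u),
      (presAtM D hlog u).comparison j x e ∈
          (((ratChar u : ℕ) : ℚ_[ratChar u]) ^ m e) • (logPacket (ratChar u) ((presAtM D hlog u).kk e) : Set ((presAtM D hlog u).X e)) ∧
        (presAtM D hlog u).comparison j x e ∉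
          (((ratChar u : ℕ) : ℚ_[ratChar u]) ^ (m e + 1)) • (logPacket (ratChar u) ((presAtM D hlog u).kk e) : Set ((presAtM D hlog u).X e)) := by
  classical
  obtain ⟨y, hyU, hy1⟩ := Set.not_subset.mp hm1
  have hy0 := hm0 hyU
  obtain ⟨a, hya⟩ := Set.mem_iUnion.mp hyU
  obtain ⟨σ, rfl⟩ : ∃ σ : Equiv.Perm ((thetaIndexOfInitial D).Caps j), σ (Fin.last _) = a :=
    ⟨Equiv.swap (Fin.last _) a, Equiv.swap_apply_left _ _⟩
  -- the slot-`σ(last)` box at `v⃗` is `perm_σ` of the last-slot box at `v⃗∘σ`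
  have hbox : ⇑(permAlgEquiv (ratChar u) ((presAtM D hlog u).kk e) σ) ''
      (presAtM D hlog u).sharpBox (t u) j (e ∘ σ) =
      iota (ratChar u) ((presAtM D hlog u).kk e) (σ (Fin.last _))
          ((presAtM D hlog u).labelIdele (t u) j (e (σ (Fin.last _)))) •
        (normalizedPacket (ratChar u) ((presAtM D hlog u).kk e) : Set ((presAtM D hlog u).X e)) := by
    rw [PadicPresentation.sharpBox]
    exact image_permAlgEquiv_iota_smul_normalizedPacket (ratChar u) ((presAtM D hlog u).kk e) σ (Fin.last _) _
  rw [← hbox] at hya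
  obtain ⟨z, hz, hzy⟩ := hya
  have hB0 : ∀ e', (0 : (presAtM D hlog u).X e') ∈ (presAtM D hlog u).sharpBox (t u) j e' :=
    fun e' => Set.mem_smul_set.mpr ⟨0, Subring.zero_mem _, smul_zero _⟩
  obtain ⟨x, hxU, hx⟩ := exists_mem_sUnion_possibleImages_comparison_eq_permX
    (P := settingPrVolSharpM D hlog t tq M archPk archSub Ψ act Mmod region n lat sig split qData htq0 Sq htq1)
    (presAtM D hlog u) j ((presAtM D hlog u).sharpBox (t u) j)
    (subset_of_eq (thetaRegion3_settingPrVolSharpM_eq_preimage_pi D hlog tq M archPk archSub Ψ act Mmod region n lat sig split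
      qData htq0 Sq htq1 t j u).symm)
    hB0 e σ hz
  refine ⟨x, hxU, ?_⟩
  have hxy : (presAtM D hlog u).comparison j x e = y := hx.trans hzy
  rw [hxy]
  exact ⟨hy0, hy1⟩

/-- **THE PER-PACKET CRITERION AT THE M LEVEL (content form)**: for a capsule-symmetric EXACT content family `m` of the (Ind1)-slot unions
`⋃_a ι_a(t_{Θ,j,v̲_a})·(R_I)^∼` and elements `cout(v̲)` of LARGEST norm in the `log_p(𝒪^×_{K_{v̲}})`:
`qRegion (j,u) ⊆ ⁿ˒°𝒰_{j,u} ⟺ ∀ v⃗, p_u^{m(v⃗)}·‖t_{q,v̲_j}‖ ≤ ∏_a ‖cout(v̲_a)‖` (part 1 at abc-iut-w5-d166's presentation `presAtM`: `hframe`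
abc-iut-s2-p7, `hq` definitional, `hism` abc-iut-s2-p9, `hsub`/`hwit` above; `‖c_{q,(v⃗,J)}‖ = ‖t_{q,v̲_j}‖`).
[cite: Mochizuki2012, IUTchIII Cor. 3.12 Step (xi-f) p. 184; Thm. 3.11 (i) p. 154] [cite: DupuyHilado2025, §3.9, §4.9, §4.12] -/
theorem qRegion_subset_thetaHull_settingPrVolSharpM_iff_of_content (j : (thetaIndexOfInitial D).Label) (u : FinitePlace ℚ)
    (m : ((thetaIndexOfInitial D).Caps j → (thetaIndexOfInitial D).Fibre (Val.non u)) → ℤ)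
    (hsymm : ∀ (σ : Equiv.Perm ((thetaIndexOfInitial D).Caps j))
      (e : (thetaIndexOfInitial D).Caps j → (thetaIndexOfInitial D).Fibre (Val.non u)), m (e ∘ σ) = m e)
    (hm0 : ∀ e : (thetaIndexOfInitial D).Caps j → (thetaIndexOfInitial D).Fibre (Val.non u),
      (⋃ a, iota (ratChar u) ((presAtM D hlog u).kk e) a ((presAtM D hlog u).labelIdele (t u) j (e a)) •
          (normalizedPacket (ratChar u) ((presAtM D hlog u).kk e) : Set ((presAtM D hlog u).X e))) ⊆
        (((ratChar u : ℕ) : ℚ_[ratChar u]) ^ m e) • (logPacket (ratChar u) ((presAtM D hlog u).kk e) : Set ((presAtM D hlog u).X e)))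
    (hm1 : ∀ e : (thetaIndexOfInitial D).Caps j → (thetaIndexOfInitial D).Fibre (Val.non u),
      ¬ (⋃ a, iota (ratChar u) ((presAtM D hlog u).kk e) a ((presAtM D hlog u).labelIdele (t u) j (e a)) •
          (normalizedPacket (ratChar u) ((presAtM D hlog u).kk e) : Set ((presAtM D hlog u).X e))) ⊆
        (((ratChar u : ℕ) : ℚ_[ratChar u]) ^ (m e + 1)) • (logPacket (ratChar u) ((presAtM D hlog u).kk e) : Set ((presAtM D hlog u).X e)))
    (cout : ∀ x : (thetaIndexOfInitial D).Fibre (Val.non u), kOfM D (ratChar u) u (natCast_ratChar_mem u) x)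
    (houtΛ : ∀ x, cout x ∈ logUnits (kOfM D (ratChar u) u (natCast_ratChar_mem u) x))
    (hdom : ∀ x, ∀ z ∈ logUnits (kOfM D (ratChar u) u (natCast_ratChar_mem u) x), ‖z‖ ≤ ‖cout x‖) :
    (settingPrVolSharpM D hlog t tq M archPk archSub Ψ act Mmod region n lat sig split qData htq0 Sq htq1).qRegion j (Val.non u) ⊆
      (settingPrVolSharpM D hlog t tq M archPk archSub Ψ act Mmod region n lat sig split qData htq0 Sq htq1).thetaHull j (Val.non u) ↔
      ∀ e : (thetaIndexOfInitial D).Caps j → (thetaIndexOfInitial D).Fibre (Val.non u),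
        (ratChar u : ℝ) ^ m e * ‖tq u (e (Fin.last _))‖ ≤ ∏ a, ‖cout (e a)‖ := by
  classical
  letI : Fintype ((presAtM D hlog u).factorIdx j) := factorIdxM_fintype D hlog j (Val.non u)
  have key := qRegion_subset_thetaHull_iff_of_content
    (P := settingPrVolSharpM D hlog t tq M archPk archSub Ψ act Mmod region n lat sig split qData htq0 Sq htq1)
    (presAtM D hlog u) j
    (frame_settingPrVolSharpM_non D hlog t tq M archPk archSub Ψ act Mmod region n lat sig split qData htq0 Sq htq1 j u)
    ((presAtM D hlog u).qCentre (tq u) j) rfl m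
    (sUnion_possibleImages_settingPrVolSharpM_subset D hlog t tq M archPk archSub Ψ act Mmod region n lat sig split qData htq0
      Sq htq1 j u m hsymm hm0)
    (fun e => exists_mem_sUnion_possibleImages_settingPrVolSharpM_exact_content D hlog t tq M archPk archSub Ψ act Mmod region
      n lat sig split qData htq0 Sq htq1 j u m e (hm0 e) (hm1 e))
    (fun e g' hg' => exists_indGroup_comparison_eq_congr_presAtM D hlog M archPk archSub Ψ act Mmod region j u e g' hg')
    cout houtΛ hdom
  rw [key]
  have hp0 : (0 : ℝ) < ratChar u := by exact_mod_cast (Fact.out : (ratChar u).Prime).pos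
  -- `‖c_{q,(v⃗,J)}‖ = ‖t_{q,v̲_j}‖` and `‖p^m‖ = p^{-m}`
  constructor
  · intro h e
    obtain ⟨J⟩ := (inferInstance : Nonempty (DIdx (ratChar u) ((presAtM D hlog u).kk e)))
    have h' := h e J
    rw [(presAtM D hlog u).norm_qCentre (tq u) j e J, Padic.norm_p_zpow, zpow_neg, ← div_eq_inv_mul,
      le_div_iff₀ (zpow_pos hp0 _), mul_comm] at h'
    exact h'
  · intro h e J
    rw [(presAtM D hlog u).norm_qCentre (tq u) j e J, Padic.norm_p_zpow, zpow_neg, ← div_eq_inv_mul, le_div_iff₀ (zpow_pos hp0 _), mul_comm]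
    exact h e

/-- **The archimedean packets are automatic**: at `v_ℚ = ∞` every Kummer image of the Θ-pilot is the whole packet (trivial archimedean
container, abc-iut-s2-p8), so the hull of the possible images is everything. [cite: Mochizuki2012, IUTchIV Thm. 1.10 Step (vii) p. 30] -/
theorem qRegion_subset_thetaHull_settingPrVolSharpM_arc (j : (thetaIndexOfInitial D).Label) (w : InfinitePlace ℚ) :
    (settingPrVolSharpM D hlog t tq M archPk archSub Ψ act Mmod region n lat sig split qData htq0 Sq htq1).qRegion j
        (Val.arc w) ⊆
      (settingPrVolSharpM D hlog t tq M archPk archSub Ψ act Mmod region n lat sig split qData htq0 Sq htq1).thetaHull j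
        (Val.arc w) := by
  intro x _
  have h0 : x ∈ (settingPrVolSharpM D hlog t tq M archPk archSub Ψ act Mmod region n lat sig split qData htq0 Sq
      htq1).thetaRegion3 j (Val.arc w) := by
    rw [thetaRegion3_settingPrVolSharpM_eq D hlog M archPk archSub Ψ act Mmod region n lat sig split qData t tq htq0 Sq htq1 0,
      thetaRegion_settingPrVolSharpM_arc]
    exact Set.mem_univ _
  exact ((settingPrVolSharpM D hlog t tq M archPk archSub Ψ act Mmod region n lat sig split qData htq0 Sq htq1).frame j
    (Val.arc w)).subset_hull _ (Set.subset_sUnion_of_mem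
      ((settingPrVolSharpM D hlog t tq M archPk archSub Ψ act Mmod region n lat sig split qData htq0 Sq
        htq1).thetaRegion3_mem_possibleImages j (Val.arc w)) h0)

/-! ## §3. The content-free closed forms -/

/-- **THE PER-PACKET CRITERION, content-free**: for NON-ZERO Θ-ideles and `cout(v̲)` of largest norm in `log_p(𝒪^×_{K_{v̲}})`,
`qRegion (j,u) ⊆ ⁿ˒°𝒰_{j,u}` ⟺ for every summand `v⃗` and every `m ∈ ℤ` with slot union `⊆ p^m·log_p(R_{v⃗}^×)`: `p^m·‖t_{q,v̲_j}‖ ≤ ∏_a ‖cout(v̲_a)‖`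
(the slot unions HAVE an exact content, capsule-symmetric — abc-iut-s2-p7 `exists_content_slotUnion` / `content_slotUnion_perm` —; the right
side is monotone in the exponent). [cite: Mochizuki2012, IUTchIII Cor. 3.12 Step (xi-f) p. 184] [cite: WeilBNT1967, Ch. II §2, Th. 2] -/
theorem qRegion_subset_thetaHull_settingPrVolSharpM_iff (ht0 : ∀ u i x, t u i x ≠ 0) (j : (thetaIndexOfInitial D).Label)
    (u : FinitePlace ℚ)
    (cout : ∀ x : (thetaIndexOfInitial D).Fibre (Val.non u), kOfM D (ratChar u) u (natCast_ratChar_mem u) x)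
    (houtΛ : ∀ x, cout x ∈ logUnits (kOfM D (ratChar u) u (natCast_ratChar_mem u) x))
    (hdom : ∀ x, ∀ z ∈ logUnits (kOfM D (ratChar u) u (natCast_ratChar_mem u) x), ‖z‖ ≤ ‖cout x‖) :
    (settingPrVolSharpM D hlog t tq M archPk archSub Ψ act Mmod region n lat sig split qData htq0 Sq htq1).qRegion j (Val.non u) ⊆
      (settingPrVolSharpM D hlog t tq M archPk archSub Ψ act Mmod region n lat sig split qData htq0 Sq htq1).thetaHull j (Val.non u) ↔
      ∀ (e : (thetaIndexOfInitial D).Caps j → (thetaIndexOfInitial D).Fibre (Val.non u)) (m : ℤ),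
        (⋃ a, iota (ratChar u) ((presAtM D hlog u).kk e) a ((presAtM D hlog u).labelIdele (t u) j (e a)) •
            (normalizedPacket (ratChar u) ((presAtM D hlog u).kk e) : Set ((presAtM D hlog u).X e))) ⊆
          (((ratChar u : ℕ) : ℚ_[ratChar u]) ^ m) • (logPacket (ratChar u) ((presAtM D hlog u).kk e) : Set ((presAtM D hlog u).X e)) →
        (ratChar u : ℝ) ^ m * ‖tq u (e (Fin.last _))‖ ≤ ∏ a, ‖cout (e a)‖ := by
  classical
  -- the exact content family of the slot unions, capsule-symmetric
  have hx0 : ∀ (e : (thetaIndexOfInitial D).Caps j → (thetaIndexOfInitial D).Fibre (Val.non u)) (a : (thetaIndexOfInitial D).Caps j),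
      (presAtM D hlog u).labelIdele (t u) j (e a) ≠ 0 :=
    fun e a => (presAtM D hlog u).labelIdele_ne_zero (t u) (ht0 u) j (e a)
  have hex := fun e : (thetaIndexOfInitial D).Caps j → (thetaIndexOfInitial D).Fibre (Val.non u) =>
    exists_content_slotUnion (ratChar u) ((presAtM D hlog u).kk e) (fun a => (presAtM D hlog u).labelIdele (t u) j (e a))
      (hx0 e)
  choose m hm0 hm1 using hex
  have hsymm : ∀ (σ : Equiv.Perm ((thetaIndexOfInitial D).Caps j))
      (e : (thetaIndexOfInitial D).Caps j → (thetaIndexOfInitial D).Fibre (Val.non u)), m (e ∘ σ) = m e := fun σ e =>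
    content_slotUnion_perm (ratChar u) ((presAtM D hlog u).kk e) σ (fun a => (presAtM D hlog u).labelIdele (t u) j (e a))
      (hm0 (e ∘ σ)) (hm1 (e ∘ σ)) (hm0 e) (hm1 e)
  rw [qRegion_subset_thetaHull_settingPrVolSharpM_iff_of_content D hlog t tq M archPk archSub Ψ act Mmod region n lat sig split
    qData htq0 Sq htq1 j u m hsymm hm0 hm1 cout houtΛ hdom]
  have hp1 : (1 : ℝ) ≤ ratChar u := by exact_mod_cast (Fact.out : (ratChar u).Prime).one_lt.le
  refine forall_congr' fun e => ⟨fun h m' hm' => ?_, fun h => h (m e) (hm0 e)⟩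
  -- `m' ≤ m(v⃗)` by exactness of the content; the right side is monotone in the exponent
  have hle : m' ≤ m e := by
    by_contra hlt
    exact hm1 e (hm'.trans (zpow_smul_logPacket_anti (ratChar u) ((presAtM D hlog u).kk e) (by omega)))
  calc (ratChar u : ℝ) ^ m' * ‖tq u (e (Fin.last _))‖ ≤ (ratChar u : ℝ) ^ m e * ‖tq u (e (Fin.last _))‖ :=
        mul_le_mul_of_nonneg_right (zpow_le_zpow_right₀ hp1 hle) (norm_nonneg _)
    _ ≤ _ := h

section Radii

/-! abc-iut-c312-5's BINDER CONVENTION per place `v̲` over `u`: INNER radius `cin u v̲` (largest ball inside `log_p(𝒪^×_{K_{v̲}})`: `hin0`, `hin`,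
maximality `hmax`); OUTER radius `cout u v̲ ∈ log_p(𝒪^×_{K_{v̲}})` of largest norm (`houtΛ`, `hdom`); NON-ZERO Θ-ideles (`ht0`). -/

variable (ht0 : ∀ u i x, t u i x ≠ 0)
  (cin cout : ∀ (u : FinitePlace ℚ) (x : (thetaIndexOfInitial D).Fibre (Val.non u)),
    kOfM D (ratChar u) u (natCast_ratChar_mem u) x)
  (hin0 : ∀ u x, cin u x ≠ 0)
  (hin : ∀ u x (o : kOfM D (ratChar u) u (natCast_ratChar_mem u) x), ‖o‖ ≤ 1 →
    cin u x * o ∈ logUnits (kOfM D (ratChar u) u (natCast_ratChar_mem u) x))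
  (hmax : ∀ u x, ∃ (ϖ : (kOfM D (ratChar u) u (natCast_ratChar_mem u) x)ˣ)
    (w : kOfM D (ratChar u) u (natCast_ratChar_mem u) x),
    IsUniformizer ϖ ∧ w ∉ logUnits (kOfM D (ratChar u) u (natCast_ratChar_mem u) x) ∧
      ‖w‖ * ‖(ϖ : kOfM D (ratChar u) u (natCast_ratChar_mem u) x)‖ ≤ ‖cin u x‖)
  (houtΛ : ∀ u x, cout u x ∈ logUnits (kOfM D (ratChar u) u (natCast_ratChar_mem u) x))
  (hdom : ∀ u x, ∀ z ∈ logUnits (kOfM D (ratChar u) u (natCast_ratChar_mem u) x), ‖z‖ ≤ ‖cout u x‖)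

include ht0 hin0 hin hmax houtΛ hdom

/-- **THE PER-PACKET CRITERION in closed form (inner and outer radii)** — the M-setting twin of abc-iut-c312-5's per-summand cell
`iota_smul_subset_packetHull_factorwiseOrbit_iota_smul_iff`, with the (Ind1)-SLOT UNION in place of one Θ-box:
`qRegion (j,u) ⊆ ⁿ˒°𝒰_{j,u} ⟺ ∀ v⃗ ∀ m ∈ ℤ, (∀ a J, p^m·‖t_{Θ,j,v̲_a}‖ ≤ p^{−(d_I − d_{L_J})}·∏_b ρ_in(v̲_b)) → p^m·‖t_{q,v̲_j}‖ ≤ ∏_b ρ_out(v̲_b)`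
(abc-iut-c312-5 `iota_smul_normalizedPacket_subset_zpow_smul_logPacket_iff` per slot). [cite: Mochizuki2012, IUTchIV Prop. 1.1 p. 9,
Prop. 1.2 (i)(ii) p. 10; IUTchIII Cor. 3.12 Step (xi-f) p. 184] [cite: DupuyHilado2025, §3.7, §4.9, §4.12] -/
theorem qRegion_subset_thetaHull_settingPrVolSharpM_iff_radii (j : (thetaIndexOfInitial D).Label) (u : FinitePlace ℚ) :
    (settingPrVolSharpM D hlog t tq M archPk archSub Ψ act Mmod region n lat sig split qData htq0 Sq htq1).qRegion j (Val.non u) ⊆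
      (settingPrVolSharpM D hlog t tq M archPk archSub Ψ act Mmod region n lat sig split qData htq0 Sq htq1).thetaHull j (Val.non u) ↔
      ∀ (e : (thetaIndexOfInitial D).Caps j → (thetaIndexOfInitial D).Fibre (Val.non u)) (m : ℤ),
        (∀ (a : (thetaIndexOfInitial D).Caps j) (J : DIdx (ratChar u) ((presAtM D hlog u).kk e)),
          (ratChar u : ℝ) ^ m * ‖(presAtM D hlog u).labelIdele (t u) j (e a)‖ ≤
            (ratChar u : ℝ) ^ (-(dSum (ratChar u) ((presAtM D hlog u).kk e) -
              differentOrd (ratChar u) (DFac (ratChar u) ((presAtM D hlog u).kk e) J))) * ∏ b, ‖cin u (e b)‖) →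
        (ratChar u : ℝ) ^ m * ‖tq u (e (Fin.last _))‖ ≤ ∏ b, ‖cout u (e b)‖ := by
  rw [qRegion_subset_thetaHull_settingPrVolSharpM_iff D hlog t tq M archPk archSub Ψ act Mmod region n lat sig split qData htq0 Sq
    htq1 ht0 j u (cout u) (houtΛ u) (hdom u)]
  refine forall_congr' fun e => forall_congr' fun m => imp_congr ?_ Iff.rfl
  exact Set.iUnion_subset_iff.trans (forall_congr' fun a =>
    iota_smul_normalizedPacket_subset_zpow_smul_logPacket_iff (ratChar u) ((presAtM D hlog u).kk e)
      (c := fun b => cin u (e b)) (fun b => hin0 u (e b)) (fun b => hin u (e b)) (fun b => hmax u (e b)) a _ m)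

/-! ## §4. The (xi-f) licence and the hull-level clause S_H at the M-level setting of record -/

/-- **THE (xi-f) LICENCE AT THE M LEVEL, decided** — `Thm311ToCor312.Licence` of abc-iut-s2-p8's summand-route sharp setting («at every
label `j = i+1 ∈ 𝔽_l^⋇` and every `v_ℚ` the q-pilot region lies in `ⁿ˒°𝒰_{j,v_ℚ}`») ⟺ the closed-form per-packet condition of §3 at every
finite rational place and every label `i+1` (archimedean packets automatic, §2). For the q-pinned reading this IS the branch-C binder S_H
on `𝔽_l^⋇` (abc-iut-w5-d068 `licence_of_pilotKummerCompatHull`). Sharp reading, OUR typed (Ind1)/(Ind2); nothing about the printed GLOBAL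
inequality. [cite: Mochizuki2012, IUTchIII Cor. 3.12 p. 173–174, Step (xi-f) p. 184] [cite: DupuyHilado2025, §4.9, §4.12] -/
theorem licence_settingPrVolSharpM_iff_radii :
    Thm311ToCor312.Licence
        (settingPrVolSharpM D hlog t tq M archPk archSub Ψ act Mmod region n lat sig split qData htq0 Sq htq1) ↔
      ∀ (u : FinitePlace ℚ) (i : Fin (thetaIndexOfInitial D).lstar)
        (e : (thetaIndexOfInitial D).Caps (Setting.labelSucc i) → (thetaIndexOfInitial D).Fibre (Val.non u)) (m : ℤ),
        (∀ (a : (thetaIndexOfInitial D).Caps (Setting.labelSucc i))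
            (J : DIdx (ratChar u) ((presAtM D hlog u).kk e)),
          (ratChar u : ℝ) ^ m * ‖t u i (e a)‖ ≤
            (ratChar u : ℝ) ^ (-(dSum (ratChar u) ((presAtM D hlog u).kk e) -
              differentOrd (ratChar u) (DFac (ratChar u) ((presAtM D hlog u).kk e) J))) * ∏ b, ‖cin u (e b)‖) →
        (ratChar u : ℝ) ^ m * ‖tq u (e (Fin.last _))‖ ≤ ∏ b, ‖cout u (e b)‖ := by
  constructor
  · intro h u i e m hm
    refine (qRegion_subset_thetaHull_settingPrVolSharpM_iff_radii D hlog t tq M archPk archSub Ψ act Mmod region n lat sig split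
      qData htq0 Sq htq1 ht0 cin cout hin0 hin hmax houtΛ hdom (Setting.labelSucc i) u).mp (h i (Val.non u)) e m fun a J => ?_
    rw [PadicPresentation.labelIdele_labelSucc]
    exact hm a J
  · intro h i vQ
    rcases vQ with w | u
    · exact qRegion_subset_thetaHull_settingPrVolSharpM_arc D hlog t tq M archPk archSub Ψ act Mmod region n lat sig split qData
        htq0 Sq htq1 _ w
    · refine (qRegion_subset_thetaHull_settingPrVolSharpM_iff_radii D hlog t tq M archPk archSub Ψ act Mmod region n lat sig
        split qData htq0 Sq htq1 ht0 cin cout hin0 hin hmax houtΛ hdom (Setting.labelSucc i) u).mpr fun e m hm =>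
        h u i e m fun a J => ?_
      have := hm a J
      rwa [PadicPresentation.labelIdele_labelSucc] at this

/-- **THE HULL-LEVEL CLAUSE AT EVERY LABEL (the body of S_H for the q-pinned reading, part 1 `pilotKummerCompatHull_const_iff`),
decided** — the label `0` included (there the Θ-idele is `1`): `∀ j v_ℚ, qRegion ⊆ ⁿ˒°𝒰_{j,v_ℚ}` ⟺ the §3 condition at every `(j, u)`.
[cite: Mochizuki2012, IUTchIII Cor. 3.12 Step (xi-d) p. 183, (xi-f) p. 184] [cite: DupuyHilado2025, §3.9, §4.12] -/
theorem forall_qRegion_subset_thetaHull_settingPrVolSharpM_iff_radii :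
    (∀ (j : (thetaIndexOfInitial D).Label) (vQ : (thetaIndexOfInitial D).VQ),
      (settingPrVolSharpM D hlog t tq M archPk archSub Ψ act Mmod region n lat sig split qData htq0 Sq htq1).qRegion j vQ ⊆
        (settingPrVolSharpM D hlog t tq M archPk archSub Ψ act Mmod region n lat sig split qData htq0 Sq htq1).thetaHull j vQ) ↔
      ∀ (u : FinitePlace ℚ) (j : (thetaIndexOfInitial D).Label)
        (e : (thetaIndexOfInitial D).Caps j → (thetaIndexOfInitial D).Fibre (Val.non u)) (m : ℤ),
        (∀ (a : (thetaIndexOfInitial D).Caps j) (J : DIdx (ratChar u) ((presAtM D hlog u).kk e)),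
          (ratChar u : ℝ) ^ m * ‖(presAtM D hlog u).labelIdele (t u) j (e a)‖ ≤
            (ratChar u : ℝ) ^ (-(dSum (ratChar u) ((presAtM D hlog u).kk e) -
              differentOrd (ratChar u) (DFac (ratChar u) ((presAtM D hlog u).kk e) J))) * ∏ b, ‖cin u (e b)‖) →
        (ratChar u : ℝ) ^ m * ‖tq u (e (Fin.last _))‖ ≤ ∏ b, ‖cout u (e b)‖ := by
  constructor
  · intro h u j
    exact (qRegion_subset_thetaHull_settingPrVolSharpM_iff_radii D hlog t tq M archPk archSub Ψ act Mmod region n lat sig split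
      qData htq0 Sq htq1 ht0 cin cout hin0 hin hmax houtΛ hdom j u).mp (h j (Val.non u))
  · intro h j vQ
    rcases vQ with w | u
    · exact qRegion_subset_thetaHull_settingPrVolSharpM_arc D hlog t tq M archPk archSub Ψ act Mmod region n lat sig split qData
        htq0 Sq htq1 j w
    · exact (qRegion_subset_thetaHull_settingPrVolSharpM_iff_radii D hlog t tq M archPk archSub Ψ act Mmod region n lat sig split
        qData htq0 Sq htq1 ht0 cin cout hin0 hin hmax houtΛ hdom j u).mpr (h u j)

end Radii

end Summit.ABC.IUTFork.Thm311.Real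

end
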